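import Summits.ResolutionOfSingularities.ResolutionOfSingularities.Theorems.FrobeniusClosingSteerInsepStepChart
import Summits.ResolutionOfSingularities.ResolutionOfSingularities.Theorems.FrobeniusClosingSteerMemberDerivationFrame
import Summits.ResolutionOfSingularities.ResolutionOfSingularities.Theorems.FrobeniusClosingSteerMemberDerivationsResidue
import Summits.ResolutionOfSingularities.ResolutionOfSingularities.Theorems.ValuativeLuAlphaPTorsorQuadraticDerivation
import Mathlib.RingTheory.Localization.AtPrime.Basic
import Mathlib.RingTheory.Valuation.LocalSubring
import HarnessLib

/-!
# Steer / LEMMA I kernel, file F3: THE DERIVATIONS — the 𝔪₀-adapted kernel-exact frame of the old member (L7-Ω from the geometric chart) and its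
# extension to the new member along the point step (H4); values on the chart coordinates; `E₁ S₁ ⊆ X S₁`

OURS (campaign res-hironaka, rung L ★L-G4, slot W4.1, crux `Steer` stmt-ResolutionOfSingularities-16345; res-L0-w41-plan-1 RULING 155a, kernel of
res-L0-w41-idea-3's LEMMA I `InsepStepNotIsolated`; res-L0-w41-stub-3 g7, blueprint `KERNEL-BLUEPRINT-LemmaI.md` 693d33707585fe97 §3; replaces the role
of no printed item; NOT a statement of the manuscript under review [claim: Hironaka2017, status: under-review]; AI review is weaker than expert review).
Theses-free, definition-free.

* §1 `exists_frame_of_chart` — a geometric chart `S₀ = A_Q` (`A` f.g. over a PERFECT field `k ⊆ L` of characteristic `2`) which is a regular local ring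
  carries, for ANY minimal system of generators `x` of `𝔪₀`, res-L0-w41-stub-4's 𝔪-adapted dual `p`-basis frame (`MemberDerivationFrame.exists_frame_int`):
  `dx i (x i') = δ`, `du j (x i) = 0`, `du j (u j') = δ`, residue derivations dual to the residues of `u` with common kernel `κ₀²`
  (`IsLocalization.AtPrime` from the chart, as in `…GeomChartResidueImperfect`; `Algebra.EssFiniteType` by composition).
* §2 `exists_derivation_extend` — every LOGARITHMIC `ℤ`-derivation of `S₀` extends to `S₁` along a quadratic transform `S₀ ≤ S₁` (Chevalley's valuation
  ring dominating `S₁`, the tree's `IsQuadraticTransform.along`, and H4 `PfaffLine.exists_derivation_quadraticTransformAlong`).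
* §3 values of an extension on the chart coordinates `t = Y/X`, `z' = Z/X` (`apply_div_eq`), squares are constants in characteristic `2`
  (`derivation_sq`), powers of ideals (`apply_mem_pow_of_log`), and **`apply_mem_span_exc_of_euler`**: the extension `E₁` of the Euler-type derivation
  `E = Σ xᵢ dxᵢ` (`E xᵢ = xᵢ`, `E S₀ ⊆ 𝔪₀`) maps ALL of `S₁` into `X S₁` (closure induction on `S₀[𝔪₀/X]`, then the quotient rule).
[cite: Matsumura1987, Thm. 30.6; §26 Thm. 26.5] [cite: Cutkosky2014, §2.1–2.2] [folklore]
-/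

noncomputable section

-- single-problem summit: the doubled namespace component `ResolutionOfSingularities` is forced
set_option linter.dupNamespace false

namespace Summit.ResolutionOfSingularities.ResolutionOfSingularities.Theorems.SwitchingDichotomy.LemmaI

open IsLocalRing Literature.AlgebraicGeometry.Resolution
open Summit.ResolutionOfSingularities.ResolutionOfSingularities.Theorems.SwitchingDichotomy

/-! ## §1 The frame of a geometric chart -/

section Frame

variable {k L : Type} [Field k] [Field L] [Algebra k L]

/-- **A geometric chart is the localisation `A_Q`** (for the inclusion algebra `A → S`); packaged as the existence of SOME `A`-algebra structure on
`S` agreeing with the inclusion into `L` which is a localisation at `Q`. [folklore] -/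
theorem exists_algebra_isLocalization (A : Subalgebra k L) (Q : Ideal A) [hQ : Q.IsPrime] (S : Subring L)
    (hS : ∀ z : L, z ∈ S ↔ ∃ a b : A, b ∉ Q ∧ z = (a : L) / (b : L)) :
    ∃ _ : Algebra A S, (∀ a : A, ((algebraMap A S a : S) : L) = a) ∧ IsLocalization.AtPrime S Q := by
  have hAS : ∀ a : A, (a : L) ∈ S := fun a =>
    (hS a).mpr ⟨a, 1, fun h => hQ.ne_top ((Ideal.eq_top_iff_one Q).mpr h), by simp⟩
  have hne : ∀ {b : A}, b ∉ Q → (b : L) ≠ 0 := fun {b} hb h =>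
    hb (by rw [ZeroMemClass.coe_eq_zero.mp h]; exact Q.zero_mem)
  let φ : A →+* S :=
    { toFun := fun a => ⟨(a : L), hAS a⟩
      map_one' := Subtype.ext (by simp)
      map_mul' := fun a b => Subtype.ext (by simp)
      map_zero' := Subtype.ext (by simp)
      map_add' := fun a b => Subtype.ext (by simp) }
  letI : Algebra A S := φ.toAlgebra
  have hφ : ∀ a : A, ((algebraMap A S a : S) : L) = (a : L) := fun a => rfl
  refine ⟨φ.toAlgebra, hφ, (isLocalization_iff _ _).mpr ⟨?_, ?_, ?_⟩⟩
  · rintro ⟨y, hy⟩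
    have hy' : y ∉ Q := Ideal.mem_primeCompl_iff.mp hy
    have hinv : (y : L)⁻¹ ∈ S := (hS _).mpr ⟨1, y, hy', by simp⟩
    refine IsUnit.of_mul_eq_one ⟨(y : L)⁻¹, hinv⟩ (Subtype.ext ?_)
    simp only [Subring.coe_mul, hφ, Subring.coe_one]
    exact mul_inv_cancel₀ (hne hy')
  · intro z
    obtain ⟨a, b, hb, hz⟩ := (hS z).mp z.2
    refine ⟨(a, ⟨b, Ideal.mem_primeCompl_iff.mpr hb⟩), Subtype.ext ?_⟩
    simp only [Subring.coe_mul, hφ]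
    rw [hz, div_mul_cancel₀ _ (hne hb)]
  · intro x y hxy
    refine ⟨1, ?_⟩
    have hxy' : (x : L) = (y : L) := by simpa [hφ] using congrArg (fun s : S => (s : L)) hxy
    rw [Subtype.ext hxy']

/-- **L7-Ω for a geometric chart.** Let `S₀ ⊆ L` be a geometric chart (`S₀ = A_Q`, `A` finitely generated over a PERFECT field `k ⊆ L` of characteristic
`2`) which is a regular local ring, and `x : Fin 3 → S₀` a minimal system of generators of `𝔪₀` (`emb dim = 3`). Then `S₀` carries an 𝔪-ADAPTED DUAL
`2`-BASIS FRAME: `u : Fin e → S₀` whose residues form a `2`-basis of `κ₀` (`κ₀ = κ₀²(ū)`), residue derivations `δ j` dual to `ū` with common kernel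
EXACTLY `κ₀²`, and `ℤ`-derivations `dx i`, `du j` of `S₀` with `dx i (x i') = δ_{ii'}`, `dx i (u j) = 0`, `du j (x i) = 0`, `du j (u j') = δ_{jj'}`
(res-L0-w41-stub-4's `MemberDerivationFrame.exists_frame_int`; `S₀` is essentially of finite type over `k` as a localisation of `A`).
[cite: Matsumura1987, Thm. 30.6 (ii); §26 Thm. 26.5] [cite: StacksProject, Tag 00TV] -/
theorem exists_frame_of_chart [PerfectField k] [CharP L 2] (S₀ : Subring L) (hreg : IsRegularLocalRing S₀)
    (hchart : ∃ (A : Subalgebra k L) (Q : Ideal A), A.FG ∧ Q.IsPrime ∧ ∀ z : L, z ∈ S₀ ↔ ∃ a b : A, b ∉ Q ∧ z = (a : L) / (b : L))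
    (x : Fin 3 → S₀) (hc : (maximalIdeal S₀).spanFinrank = 3) (hx : Ideal.span (Set.range x) = maximalIdeal S₀) :
    ∃ (e : ℕ) (u : Fin e → S₀) (δ : Fin e → Derivation ℤ (ResidueField S₀) (ResidueField S₀))
      (dx : Fin 3 → Derivation ℤ S₀ S₀) (du : Fin e → Derivation ℤ S₀ S₀),
      Subfield.closure (Set.range (fun y : ResidueField S₀ => y ^ 2) ∪ Set.range (fun j => residue S₀ (u j))) = ⊤ ∧
      (∀ j j', δ j (residue S₀ (u j')) = if j' = j then 1 else 0) ∧
      (∀ y : ResidueField S₀, (∀ j, δ j y = 0) ↔ ∃ t, t ^ 2 = y) ∧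
      (∀ i i', dx i (x i') = if i' = i then 1 else 0) ∧ (∀ i j, dx i (u j) = 0) ∧
      (∀ j i, du j (x i) = 0) ∧ (∀ j j', du j (u j') = if j' = j then 1 else 0) := by
  haveI := hreg
  obtain ⟨A, Q, hA, hQ, hS⟩ := hchart
  haveI := hQ
  obtain ⟨_, hφ, hloc⟩ := exists_algebra_isLocalization A Q S₀ hS
  haveI := hloc
  letI : Algebra k S₀ := ((algebraMap A S₀).comp (algebraMap k A)).toAlgebra
  haveI : IsScalarTower k A S₀ := IsScalarTower.of_algebraMap_eq fun _ => rfl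
  haveI : Algebra.FiniteType k A := (Subalgebra.fg_iff_finiteType A).mp hA
  haveI : Algebra.EssFiniteType A S₀ := Algebra.EssFiniteType.of_isLocalization S₀ Q.primeCompl
  haveI : Algebra.EssFiniteType k S₀ := Algebra.EssFiniteType.comp k A S₀
  haveI : CharP k 2 := (algebraMap k L).charP (algebraMap k L).injective 2
  exact MemberDerivationFrame.exists_frame_int 2 k S₀ hc x hx

end Frame

/-! ## §2 Extension of logarithmic derivations along the point step -/

section Extension

variable {L : Type} [Field L] {S₀ S₁ : Subring L} [IsLocalRing S₀] [IsLocalRing S₁]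

/-- **Logarithmic derivations extend along a quadratic transform** (`δ 𝔪₀ ⊆ 𝔪₀ ⇒ ∃ δ₁ ∈ Der(S₁)` with `δ₁|S₀ = δ`): a valuation ring `W` of `L`
dominating `S₁` exists (Chevalley, `LocalSubring.exists_le_valuationSubring`), the transform is the quadratic transform ALONG `W`
(`IsQuadraticTransform.along`), and H4 (`PfaffLine.exists_derivation_quadraticTransformAlong`) extends `δ`. [cite: Cutkosky2014, §2.2] [folklore] -/
theorem exists_derivation_extend [IsNoetherianRing S₀] (hQT : IsQuadraticTransform S₀ S₁) (h : S₀ ≤ S₁)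
    (δ : Derivation ℤ S₀ S₀) (hδ : ∀ y ∈ maximalIdeal S₀, δ y ∈ maximalIdeal S₀) :
    ∃ δ₁ : Derivation ℤ S₁ S₁, ∀ a : S₀, δ₁ (Subring.inclusion h a) = Subring.inclusion h (δ a) := by
  obtain ⟨W, hW⟩ := (LocalSubring.mk S₁).exists_le_valuationSubring
  haveI : IsLocalRing W.toSubring := inferInstanceAs (IsLocalRing W)
  have hSW : SubringDominates S₁ W.toSubring := (subringDominates_iff S₁ W.toSubring).mpr hW
  have hA : IsQuadraticTransformAlong W S₀ S₁ := hQT.along ⟨inferInstance, IsNoetherian.noetherian _⟩ hSW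
  obtain ⟨δ₁, hδ₁⟩ := PfaffLine.exists_derivation_quadraticTransformAlong W S₀ S₁ hA δ hδ
  exact ⟨δ₁, fun a => hδ₁ a⟩

end Extension

/-! ## §3 Values on the chart coordinates; squares; powers of ideals; the Euler extension -/

section Values

variable {L : Type} [Field L] {S₀ S₁ : Subring L}

/-- **Quotient rule read in `S₁`**: if `w · b = a` in `S₁` then `δ₁ w · b = δ₁ a − w · δ₁ b`. [folklore] -/
theorem apply_mul_eq_sub (δ₁ : Derivation ℤ S₁ S₁) {w a b : S₁} (hw : w * b = a) : δ₁ w * b = δ₁ a - w * δ₁ b := by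
  have := congrArg δ₁ hw
  rw [δ₁.leibniz, smul_eq_mul, smul_eq_mul] at this
  linear_combination this

/-- **Value of an extension on a chart coordinate.** If `δ₁` extends `δ` (`δ₁ ∘ ι = ι ∘ δ`), `w ∈ S₁` with `w · X = Y` (`X, Y ∈ S₀`, `X ≠ 0`), then
`δ₁ w` is determined: `δ₁ w · X = δ Y − w · δ X`. [folklore] -/
theorem apply_chart_mul (h : S₀ ≤ S₁) (δ : Derivation ℤ S₀ S₀) (δ₁ : Derivation ℤ S₁ S₁)
    (hδ₁ : ∀ a : S₀, δ₁ (Subring.inclusion h a) = Subring.inclusion h (δ a)) {w : S₁} {X Y : S₀}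
    (hw : w * Subring.inclusion h X = Subring.inclusion h Y) :
    δ₁ w * Subring.inclusion h X = Subring.inclusion h (δ Y) - w * Subring.inclusion h (δ X) := by
  rw [← hδ₁, ← hδ₁]
  exact apply_mul_eq_sub δ₁ hw

/-- Cancelling the non-zero `X`: if `δ₁ w · X = c · X` then `δ₁ w = c`. [folklore] -/
theorem eq_of_mul_eq_mul_exc (h : S₀ ≤ S₁) {X : S₀} (hX0 : (X : L) ≠ 0) {v c : S₁}
    (hv : v * Subring.inclusion h X = c * Subring.inclusion h X) : v = c := by
  have hX1 : (Subring.inclusion h X : S₁) ≠ 0 := fun e => hX0 (by simpa using congrArg Subtype.val e)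
  exact mul_right_cancel₀ hX1 hv

/-- The chart coordinate relation `(Y/X) · X = Y` in `S₁`. [folklore] -/
theorem div_mul_exc_eq (h : S₀ ≤ S₁) {X Y : S₀} (hX0 : (X : L) ≠ 0) (w : S₁) (hw : (w : L) = Y / X) :
    w * Subring.inclusion h X = Subring.inclusion h Y :=
  Subtype.ext (by simp [hw, div_mul_cancel₀ _ hX0])

/-- **Derivations kill squares in characteristic `2`.** [folklore] -/
theorem derivation_sq [CharP L 2] (δ₁ : Derivation ℤ S₁ S₁) (g : S₁) : δ₁ (g ^ 2) = 0 := by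
  rw [δ₁.leibniz_pow, ← Nat.cast_smul_eq_nsmul S₁ 2, CharP.cast_eq_zero S₁ 2, zero_smul]

/-- Hence `δ₁ (g² + h) = δ₁ h`. [folklore] -/
theorem derivation_sq_add [CharP L 2] (δ₁ : Derivation ℤ S₁ S₁) (g h' : S₁) : δ₁ (g ^ 2 + h') = δ₁ h' := by
  rw [map_add, derivation_sq, zero_add]

/-- **A logarithmic derivation preserves every power of the ideal**: `D I ⊆ I ⇒ D (I^n) ⊆ I^n`. [folklore] -/
theorem apply_mem_pow_of_log {R : Type*} [CommRing R] (D : Derivation ℤ R R) (I : Ideal R) (hlog : ∀ y ∈ I, D y ∈ I) :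
    ∀ (n : ℕ) {a : R}, a ∈ I ^ n → D a ∈ I ^ n := by
  intro n
  induction n with
  | zero => intro a _; simp
  | succ n ih =>
    intro a ha
    rw [pow_succ] at ha
    refine Submodule.mul_induction_on ha (fun m hm y hy => ?_) (fun u v hu hv => ?_)
    · rw [D.leibniz, smul_eq_mul, smul_eq_mul, pow_succ]
      exact Ideal.add_mem _ (Ideal.mul_mem_mul hm (hlog y hy)) (Submodule.mul_mem_mul_rev (ih hm) hy)
    · rw [map_add]
      exact Ideal.add_mem _ hu hv

/-- A derivation lowers the order along an ideal by at most one: `D (I^(n+1)) ⊆ I^n` (the tree's `Derivation.apply_mem_pow_sub_one`). [folklore] -/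
theorem apply_mem_pow_of_mem_pow_succ {R : Type*} [CommRing R] (D : Derivation ℤ R R) (I : Ideal R) (n : ℕ) {a : R}
    (ha : a ∈ I ^ (n + 1)) : D a ∈ I ^ n := by
  simpa using Derivation.apply_mem_pow_sub_one ℤ D I (n + 1) ha

/-- **The Euler extension maps `S₁` into `X S₁`.** Let `E₁ ∈ Der(S₁)` satisfy `E₁ (ι a) ∈ (X)` for all `a ∈ S₀` and `E₁ t = 0`, `E₁ z' = 0` for the chart
coordinates (`t = Y/X`, `z' = Z/X`, `𝔪₀ = (X, Y, Z)`); then `E₁ w ∈ (X)` for every `w ∈ S₁` — first for `w ∈ S₀[𝔪₀/X] = S₀[t, z']` by closure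
induction (Leibniz), then for fractions `w = a/b`, `b ∈ S₁ˣ`, by the quotient rule. [folklore] -/
theorem apply_mem_span_exc_of_euler [IsLocalRing S₀] (h : S₀ ≤ S₁) {X Y Z : S₀} (hXYZ : Ideal.span {X, Y, Z} = maximalIdeal S₀)
    (hX0 : (X : L) ≠ 0) (hB : blowupRing S₀ (X : L) ≤ S₁)
    (hfrac : ∀ w ∈ S₁, ∃ a ∈ blowupRing S₀ (X : L), ∃ b ∈ blowupRing S₀ (X : L), b⁻¹ ∈ S₁ ∧ w = a / b)
    (t₁ z₁ : S₁) (ht₁ : (t₁ : L) = Y / X) (hz₁ : (z₁ : L) = Z / X) (E₁ : Derivation ℤ S₁ S₁)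
    (hE₀ : ∀ a : S₀, E₁ (Subring.inclusion h a) ∈ Ideal.span {Subring.inclusion h X})
    (hEt : E₁ t₁ = 0) (hEz : E₁ z₁ = 0) : ∀ w : S₁, E₁ w ∈ Ideal.span {Subring.inclusion h X} := by
  set J : Ideal S₁ := Ideal.span {Subring.inclusion h X} with hJ
  -- (a) on the blow-up ring
  have hBring : ∀ v ∈ blowupRing S₀ (X : L), ∀ hv : v ∈ S₁, E₁ ⟨v, hv⟩ ∈ J := by
    intro v hv
    rw [blowupRing_eq_closure_triple hXYZ hX0] at hv
    induction hv using Subring.closure_induction with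
    | mem v hv =>
      intro hv₁
      rcases hv with hv | hv
      · exact hE₀ ⟨v, hv⟩
      · rcases hv with rfl | rfl
        · have : (⟨(Y : L) / X, hv₁⟩ : S₁) = t₁ := Subtype.ext (by simp [ht₁])
          rw [this, hEt]; exact zero_mem _
        · have : (⟨(Z : L) / X, hv₁⟩ : S₁) = z₁ := Subtype.ext (by simp [hz₁])
          rw [this, hEz]; exact zero_mem _
    | zero => intro hv₁; have : (⟨(0 : L), hv₁⟩ : S₁) = 0 := rfl; rw [this, map_zero]; exact zero_mem _
    | one => intro hv₁; have : (⟨(1 : L), hv₁⟩ : S₁) = 1 := rfl; rw [this, Derivation.map_one_eq_zero]; exact zero_mem _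
    | add u w hu hw ihu ihw =>
      intro hv₁
      have hu₁ : u ∈ S₁ := hB (by rwa [blowupRing_eq_closure_triple hXYZ hX0])
      have hw₁ : w ∈ S₁ := hB (by rwa [blowupRing_eq_closure_triple hXYZ hX0])
      have : (⟨u + w, hv₁⟩ : S₁) = ⟨u, hu₁⟩ + ⟨w, hw₁⟩ := rfl
      rw [this, map_add]
      exact Ideal.add_mem _ (ihu hu₁) (ihw hw₁)
    | neg u hu ihu =>
      intro hv₁
      have hu₁ : u ∈ S₁ := hB (by rwa [blowupRing_eq_closure_triple hXYZ hX0])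
      have : (⟨-u, hv₁⟩ : S₁) = -⟨u, hu₁⟩ := rfl
      rw [this, map_neg]
      exact (Submodule.neg_mem _ (ihu hu₁))
    | mul u w hu hw ihu ihw =>
      intro hv₁
      have hu₁ : u ∈ S₁ := hB (by rwa [blowupRing_eq_closure_triple hXYZ hX0])
      have hw₁ : w ∈ S₁ := hB (by rwa [blowupRing_eq_closure_triple hXYZ hX0])
      have : (⟨u * w, hv₁⟩ : S₁) = ⟨u, hu₁⟩ * ⟨w, hw₁⟩ := rfl
      rw [this, E₁.leibniz, smul_eq_mul, smul_eq_mul]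
      exact Ideal.add_mem _ (Ideal.mul_mem_left _ _ (ihw hw₁)) (Ideal.mul_mem_left _ _ (ihu hu₁))
  -- (b) fractions
  intro w
  obtain ⟨a, ha, b, hb, hbinv, hab⟩ := hfrac w w.2
  by_cases hb0 : b = 0
  · have : w = 0 := Subtype.ext (by rw [hab, hb0, div_zero]; rfl)
    rw [this, map_zero]; exact zero_mem _
  set a₁ : S₁ := ⟨a, hB ha⟩
  set b₁ : S₁ := ⟨b, hB hb⟩
  set binv : S₁ := ⟨b⁻¹, hbinv⟩
  have hwb : w * b₁ = a₁ := Subtype.ext (by simp [a₁, b₁, hab, div_mul_cancel₀ a hb0])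
  have hbb : b₁ * binv = 1 := Subtype.ext (by simp [b₁, binv, mul_inv_cancel₀ hb0])
  have key : E₁ w * b₁ = E₁ a₁ - w * E₁ b₁ := apply_mul_eq_sub E₁ hwb
  have hEwb : E₁ w * b₁ ∈ J := by
    rw [key]
    exact Ideal.sub_mem _ (hBring a ha _) (Ideal.mul_mem_left _ _ (hBring b hb _))
  have : E₁ w = (E₁ w * b₁) * binv := by rw [mul_assoc, hbb, mul_one]
  rw [this]
  exact Ideal.mul_mem_right _ _ hEwb

end Values

end Summit.ResolutionOfSingularities.ResolutionOfSingularities.Theorems.SwitchingDichotomy.LemmaI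

end
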